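/-
Copyright: lit-balaban Phase-2 proof seat p27 (gen 37).  Statement-level skeleton of a published paper; no proof claims beyond what the
kernel checks below.
-/
import Literature.MathematicalPhysics.QuantumFieldTheory.BalabanImbrieJaffe1984to88.BIJ88NeumannPropagatorSmallFieldCloseHolder
import Literature.MathematicalPhysics.QuantumFieldTheory.BalabanImbrieJaffe1984to88.BIJ88NeumannPropagatorSmallFieldSupDecay

/-!
# [BalabanImbrieJaffe1985] §7.3 p. 326 ⟵ [Balaban1983RegularityDecay] Theorem p. 573, (1.9), (1.11)–(1.12): **THE `δG_k(□, T)` HÖLDER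
# MEMBER (ORDER `1+α`) FOR A TORUS CUBE `□` AGAINST THE WHOLE TORUS, HYPOTHESIS-FREE UNDER THE BLOCK-SCALE PLAQUETTE SMALLNESS
# `(L^{2k}θ)² ≤ 1/500` ALONE** — and the four (H1.10″) inputs of the pair `(□, T)` packaged at one set of constants

T. Bałaban, *Regularity and decay of lattice Green's functions*, Commun. Math. Phys. **89** (1983) 571–597 [Balaban1983RegularityDecay]
(= [7] of [BalabanImbrieJaffe1985]), Theorem p. 573 [PDF 3], (1.9): *"1/|x − x′|^α |U(A(Γ_{x,x′}))(D^η_{A,μ}G_k(Ω,A)f)(x′) −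
(D^η_{A,μ}G_k(Ω,A)f)(x)| ≦ c₀exp(−δ₀dist({x,x′}, supp f))‖f‖_∞ for x, x′ ∈ Ω, and satisfying the condition dist({x,x′},Ω^c) ≧ R₀"*,
(1.11)–(1.12): *"If Ω ⊂ Ω₀, then for δG_k(Ω,Ω₀,A) = G_k(Ω,A) − G_k(Ω₀,A), we have the inequalities (1.5) and (1.6) (with the same
restrictions on x, x′) with the additional factor"* (1.12) *"on the right hand sides"* [the (1.12) display is BLANK on the held scan (`p0003.txt`
L23); by the audited transcription of record — r01's `BIJ85NeumannPropagatorRegularClose`, via [Balaban1982Higgs1] = CMP 85 Prop. 2.1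
(2.26) — it reads `exp(−δ₀ dist(supp f, Ω^c) − δ₀ dist({x, x′}, Ω^c))`, the point set being the PAIR `{x, x′}`; the theorems below take the
boundary distance against BOTH points (docfix of referee ref-5's D-g69-1 / D-g70-3: an earlier header presented this gloss inside the
quotation marks in single-`x` form)]; T. Bałaban,
J. Imbrie, A. Jaffe, *Renormalization of the Higgs model: minimizers, propagators and the stability of mean field theory*, Commun. Math.
Phys. **97** (1985) 299–329 [BalabanImbrieJaffe1985], §7.3 p. 326 [PDF 28] lines 18–22: *"The propagators arising from Δ_k(u_k), under the
restriction (7.3.1) on the gauge field, also satisfy the regularity and decay estimates of [7]."*  Rows **C1.Eq7.3.1-7.3.2** (owner r15) /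
front **C2S14**, cells C2.Eq2.31 / C2.Claim@263 (owner r18) / B4.Thm@573 (owner r01) — cells only, no head change.

statement-level skeleton of published theorems with citation tags; proofs where landed; nothing here is a claim about the Yang–Mills mass gap

PDFs held: `paper:balaban1983-cmp89-regularity-decay` (p. 573 = PDF 3, the Theorem (1.5)–(1.12)); `paper:balaban1985-cmp97-bij-higgs-minimizers`
(p. 326 = PDF 28) — both sentences re-read on the materialised pages by this seat (gens 34–37; same pages, same wording as quoted).

CITATION HEADER (lean-in-tree rule).  Part of the lit-balaban TYPED SKELETON (HOME `run/shared/lean/pub/lit-balaban/`), PHASE-2 proof seat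
p27 gen 37 (unit `lit-balaban-p27-g37`; TAKING #3 line HOME/STATUS.md 2026-08-23T07:17:53Z, free-target protocol G.5-34(d), window → 07:40Z,
cc p30 g28 (template), r18 / r15 / p29 FYI).  WHAT THIS FILE IS: the HÖLDER row of p30 gen 28's table
`BIJ88NeumannPropagatorSmallFieldCloseCubeTorus` (p356441: the VALUE and COVARIANT-DERIVATIVE members of the `δG_k(□,T)` clause for a torus cube
against the whole torus, hypothesis-free) — this seat's `BIJ88NeumannPropagatorSmallFieldCloseHolder.closeHolder112_smallField_of_inputs110` /
`closeHolder112_smallField_input110` (p356227: the Hölder member of the clause from the four (H1.10″) inputs, nested `k`-block unions `□ ⊆ Ω`)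
INSTANTIATED at `(□, Ω) = (cubeT (L^k) c (L^kM), T)` with the four inputs DISCHARGED BY NAME, exactly as in p30's file:
`BIJ85ScalarPropagatorSupDecay.decay110_smallField_input` (torus value, this seat gen 31), `BIJ88NeumannPropagatorSmallFieldSupDecay.
decay110_smallPlaquette_cube_uniform` (cube value under (7.3.1), this seat gen 33), `BIJ85ScalarPropagatorSupDecayDeriv.decay110_smallField_deriv`
(torus covariant derivative, p30 gen 25), `BIJ88NeumannPropagatorSmallFieldCubeDeriv.decay110_smallPlaquette_cube_deriv_uniform_input` (cube
covariant derivative under (7.3.1), p34 gen 17), at the common constants `max / min`; the thresholds of the cube members follow from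
`(L^{2k}θ)² ≤ 1/500` by the arithmetic of p31's `BIJ88DeltaLocSmallPlaquetteTorusCwt.smallness_of_threshold` (re-proved here privately, as in
p30's file, so that this propagator-level file stays below the (2.30)–(2.41) chain in the import order).  USED BY NAME, never restated: the six
theorems just listed, p31's `gBox` / `IsBlockUnion` / `isBlockUnion_univ`, this seat's `cubeT` / `isBlockUnion_cubeT`, p38's `B5Ineq137Torus.T`,
r18's `covD` / `cfg`, p30's `stairHol`, `plaqC` / `plaqC_eq_toC_plaqHol` (`BIJ85AbelianStokes`).

WHAT THIS FILE PROVES (theorems only; 0 `sorry`; standard axioms; no definition, no `Prop`-valued fact; two private kernel lemmas).  For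
`2 ≤ d′ = d + 1 ≤ 3`, `L = ℓ + 1` odd `≥ 3`, `a > 0` (and `0 ≤ α < 1` in §3–§4) there are constants depending on these only such that on every
torus of the series (`P.d = d + 1`, `P.L = ℓ + 1`), at every level `1 ≤ k ≤ K` with `2(L^k − 1) + 4 < |T^{(0)}|`, for every `U(1)` field `u` with
`‖u(∂p) − 1‖ ≤ θ`, `0 ≤ θ`, `(L^{2k}θ)² ≤ 1/500`, and every torus cube `□ = cubeT (L^k) c (L^kM)` (`M_i ≥ 1`, fitting, `L^kM_i < |T|`) —
`G_k(X,u) = gBox (α_kL^{kd′}) ε⁻¹ u k X`: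
* §2 **`inputs110_smallPlaquette_cube_torus`** — `∃ c₀ ≥ 0, δ₀ > 0`: the block-scale smallness `2d′³(L^{2k}θ)² ≤ 1` AND the four (H1.10″)
  members — the VALUE members of `G_k(□,u)`, `G_k(T,u)` on the rows of `□` (`‖(G_k(X,u)f)(x)‖ ≤ (L^kε)²·c₀e^{−δ₀D/L^k}·F`) and the
  COVARIANT-DERIVATIVE members on the rows whose open `L^k`-ball lies in `□` (`‖(D_uG_k(X,u)f)(⟨x,μ⟩)‖ ≤ (L^kε)·c₀e^{−δ₀D/L^k}·F`) — in EXACTLY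
  the hypothesis shapes `hGB` / `hGΩ` / `hDB` / `hDΩ` of p30's `close112_smallField_deriv_of_inputs` and this seat's
  `closeHolder112_smallField_of_inputs110`, at ONE `(c₀, δ₀)` (the packaging p30's two theorems perform inline, stated once for all consumers of
  the `(□, T)` pair).
* §3 **`closeHolder112_smallPlaquette_cube_torus`** — `∃ c₃, δ₃ > 0`: for every pair of distinct rows `x₀ ≠ x₁` of `□` both with
  `dist_∞(x_i, T ∖ □) ≥ 17L^k`, every `μ`, every `f` supported in `□` (`F = ‖f‖_∞`, `0 ≤ D ≤ dist(x_i, supp f)`, `0 ≤ D_b ≤ dist(x_i, T∖□)`,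
  `0 ≤ D_f ≤ dist(supp f, T∖□)`, p38's metric `T`):
  `(L^k/T(x₀,x₁))^α·‖U(Γ_{x₀,x₁})(D_uv)(⟨x₁,μ⟩) − (D_uv)(⟨x₀,μ⟩)‖ ≤ (L^kε)·c₃e^{−δ₃D/L^k}e^{−δ₃(D_b+D_f)/L^k}·F`, `v = G_k(□,u)f − G_k(T,u)f`,
  `Γ` = p30's shortest staircase `stairHol` — p30's binders (`close112_smallPlaquette_cube_torus_deriv`) with the pair in place of the row.
* §4 **`closeHolder112_smallPlaquette_cube_torus_input`** — §3 in the (H1.12)-Hölder INPUT BINDER SHAPE (direction first, `x₁ ≠ x₀`, deep rows as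
  the ball conditions `T(x_i,y) ≤ 17L^k → y ∈ □`, no sign conditions on `D, D_b, D_f`) of this seat's `closeHolder112_smallField_input110` /
  r18's `input112_holder_regular_univ`.
With §3 the three members (value, covariant derivative: p30 p356441; Hölder: here) of [Balaban1983RegularityDecay] (1.11)–(1.12) for the pair
(torus cube, whole torus) at small-plaquette `U(1)` fields are in the tree HYPOTHESIS-FREE in `k`-uniform operator form.

HONEST SCOPE.  `U(1)` (p31's carrier); `2 ≤ d′ ≤ 3`; `L` odd `≥ 3`; `1 ≤ k ≤ K`; `0 ≤ α < 1` (referee ruling G-ref1-32 on the printed «α < 0»);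
only the pair (torus cube, whole torus) — general nested block unions need the region members in the same binder shapes (this seat's
`decay110_smallField_region_deep_input`, p34's `BIJ88NeumannPropagatorSmallFieldRegionDeriv`) and are served by the `…_of_inputs110` form, not
instantiated here; pairs at OUR depth `17L^k` (our reading of the printed `R₀`; nothing nearer the boundary, no reflected kernels); the contour is
p30's explicit `stairHol`; ONE power of `L^kε` on the right; block-scale plaquette smallness as stated — THE PRINTED (7.3.1) constrains the
unit-lattice plaquettes of `v` (p. 326 L13–14), the files' `θ` the fine plaquettes of `u`; `θ ≲ L^{−2k}` is the consistent block-scale reading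
but nothing is asserted about the passage (p33's lane; referee ref-5 D-g64-1).  DIVERGENCE OF METHOD from the printed route as disclosed in the
member files ([Balaban1983RegularityDecay] p. 579 proves (1.11)–(1.12) by a random-walk cancellation; the tree applies p30's perturbative
interior Hölder estimate to the `N(u)`-harmonic difference).  This is an INPUT of the order-`(1+θ)` member of [BalabanImbrieJaffe1988] (2.31)
at small `u`, not that member.  Nothing here is summit progress, continuum or Clay.  Unit `lit-balaban-p27`
(literature-prover-lit-balaban-p27-g37-0), HOME `run/shared/lean/pub/lit-balaban/`, 2026-08-23.
-/

open scoped BigOperators ComplexConjugate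
open Finset Matrix

namespace Literature.MathematicalPhysics.QuantumFieldTheory.BalabanImbrieJaffe1984to88.BIJ88NeumannPropagatorSmallFieldCloseHolderCubeTorus

open Literature.MathematicalPhysics.QuantumFieldTheory.Balaban1983to89
open BIJ88Sect3Statements (U1 toC cfg covD)
open BIJ85AbelianStokes (plaqC plaqC_eq_toC_plaqHol)
open BIJ88NeumannNoZeroModesTorus (IsBlockUnion isBlockUnion_univ)
open BIJ88NeumannPropagator227Torus (gBox)
open BIJ88NeumannPropagatorFlatDecayCube (cubeT isBlockUnion_cubeT)
open BIJ85ScalarPropagatorSupDecay (decay110_smallField_input)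
open BIJ85ScalarPropagatorSupDecayDeriv (decay110_smallField_deriv)
open BIJ88NeumannPropagatorSmallFieldSupDecay (decay110_smallPlaquette_cube_uniform)
open BIJ88NeumannPropagatorSmallFieldCubeDeriv (decay110_smallPlaquette_cube_deriv_uniform_input)
open BIJ85ScalarPropagatorHolderDecay (stairHol)
open BIJ88NeumannPropagatorSmallFieldCloseHolder (closeHolder112_smallField_of_inputs110 closeHolder112_smallField_input110)

noncomputable section

variable {P : Params}

/-! ## §1 Kernel lemmas: monotonicity in the constants, the threshold arithmetic -/

/-- kernel (p30's `BIJ88NeumannPropagatorSmallFieldCloseCubeTorus.mono_bound`, private there): weakening the constants of a decay bound,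
`c ≤ c′`, `δ′ ≤ δ`, `E, F ≥ 0`: `c·e^{−δE}·F ≤ c′·e^{−δ′E}·F`. [folklore] -/
private theorem mono_bound {c c' δ δ' E F : ℝ} (hc : 0 ≤ c) (hcc : c ≤ c') (hδ : δ' ≤ δ) (hE : 0 ≤ E) (hF : 0 ≤ F) :
    c * Real.exp (-(δ * E)) * F ≤ c' * Real.exp (-(δ' * E)) * F :=
  mul_le_mul_of_nonneg_right (mul_le_mul hcc (Real.exp_le_exp.2 (neg_le_neg (mul_le_mul_of_nonneg_right hδ hE))) (Real.exp_pos _).le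
    (hc.trans hcc)) hF

/-- kernel (the arithmetic of p31's `BIJ88DeltaLocSmallPlaquetteTorusCwt.smallness_of_threshold`, repeated — as in p30's file — to keep the
import order): the block-scale plaquette threshold `(L^{2k}θ)² ≤ 1/500` implies, for `1 ≤ d′ ≤ 3`, `2d′³(L^{2k}θ)² ≤ 1` and, with
`T = (d′−1)(L^k−1)θ`, `2(L^k−1)L^k·d′·T² + 2(d′(L^k−1)T)² ≤ ½`. [cite: BalabanImbrieJaffe1985, (7.3.1) p.326] -/
private theorem threshold_smallness {dr n θ : ℝ} (hd1 : 1 ≤ dr) (hd3 : dr ≤ 3) (hn : 1 ≤ n) (hθ : 0 ≤ θ)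
    (hτ : (n ^ 2 * θ) ^ 2 ≤ 1 / 500) :
    2 * dr ^ 3 * (n ^ 2 * θ) ^ 2 ≤ 1 ∧
      2 * ((n - 1) * n) * dr * ((dr - 1) * (n - 1) * θ) ^ 2 + 2 * (dr * (n - 1) * ((dr - 1) * (n - 1) * θ)) ^ 2 ≤ 1 / 2 := by
  have hd0 : 0 ≤ dr := by linarith
  have hn0 : 0 ≤ n := by linarith
  have hd27 : dr ^ 3 ≤ 27 := by
    have h := pow_le_pow_left₀ hd0 hd3 3
    norm_num at h
    exact h
  have hd81 : dr ^ 4 ≤ 81 := by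
    have h := pow_le_pow_left₀ hd0 hd3 4
    norm_num at h
    exact h
  have hτ0 : 0 ≤ (n ^ 2 * θ) ^ 2 := sq_nonneg _
  refine ⟨?_, ?_⟩
  · calc 2 * dr ^ 3 * (n ^ 2 * θ) ^ 2 ≤ 2 * 27 * (1 / 500) :=
          mul_le_mul (mul_le_mul_of_nonneg_left hd27 (by norm_num)) hτ hτ0 (by norm_num)
      _ ≤ 1 := by norm_num
  · have hn1 : n - 1 ≤ n := by linarith
    have hdr1 : dr - 1 ≤ dr := by linarith
    have hn10 : 0 ≤ n - 1 := by linarith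
    have hdr10 : 0 ≤ dr - 1 := by linarith
    calc 2 * ((n - 1) * n) * dr * ((dr - 1) * (n - 1) * θ) ^ 2 + 2 * (dr * (n - 1) * ((dr - 1) * (n - 1) * θ)) ^ 2
        ≤ 2 * (n * n) * dr * (dr * n * θ) ^ 2 + 2 * (dr * n * (dr * n * θ)) ^ 2 := by gcongr
      _ = (2 * dr ^ 3 + 2 * dr ^ 4) * (n ^ 2 * θ) ^ 2 := by ring
      _ ≤ (2 * 27 + 2 * 81) * (1 / 500) := mul_le_mul (by linarith) hτ hτ0 (by norm_num)
      _ ≤ 1 / 2 := by norm_num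

/-! ## §2 The four (H1.10″) inputs of the pair (torus cube, whole torus) at one set of constants, hypothesis-free -/

/-- **THE FOUR (H1.10″) INPUTS OF THE PAIR `(□, T)` AT ONE SET OF CONSTANTS, HYPOTHESIS-FREE UNDER `(L^{2k}θ)² ≤ 1/500`** (the packaging p30's
`close112_smallPlaquette_cube_torus(_deriv)` perform inline, stated once): for `1 ≤ d`, `d + 1 ≤ 3`, `ℓ ≥ 1` with `ℓ + 1` odd, `a > 0` there are
`c₀ ≥ 0`, `δ₀ > 0` such that for every volume (`P.d = d + 1`, `P.L = ℓ + 1`), every `1 ≤ k ≤ K` with `2(L^k − 1) + 4 < |T|`, every `u` with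
`‖u(∂p) − 1‖ ≤ θ`, `0 ≤ θ`, `(L^{2k}θ)² ≤ 1/500`, and every cube `□ = cubeT (L^k) c (L^kM)` (`M_i ≥ 1`, fitting, `L^kM_i < |T|`): the block-scale
smallness `2d′³(L^{2k}θ)² ≤ 1` holds, and the (H1.10″) VALUE members of `G_k(□,u)` / `G_k(T,u)` on the rows of `□` and COVARIANT-DERIVATIVE
members on the rows whose open `L^k`-ball lies in `□` hold with `(c₀, δ₀)` — by this seat's `decay110_smallPlaquette_cube_uniform` /
`decay110_smallField_input`, p34's `decay110_smallPlaquette_cube_deriv_uniform_input`, p30's `decay110_smallField_deriv`, at `max / min`.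
[cite: Balaban1983RegularityDecay, Theorem p.573 (1.5), (1.10)] [cite: BalabanImbrieJaffe1985, (7.3.1)-(7.3.2) p.326] -/
theorem inputs110_smallPlaquette_cube_torus (d ℓ : ℕ) (hd1 : 1 ≤ d) (hd3 : d + 1 ≤ 3) (hℓ : 1 ≤ ℓ) (hodd : Odd (ℓ + 1)) {a : ℝ}
    (ha : 0 < a) :
    ∃ c₀ δ₀ : ℝ, 0 ≤ c₀ ∧ 0 < δ₀ ∧ ∀ (P : Params) (hPd : P.d = d + 1), P.L = ℓ + 1 →
      ∀ k : ℕ, 1 ≤ k → k ≤ P.K → 2 * (P.L ^ k - 1) + 4 < P.sitesPerDir 0 →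
      ∀ (U : GaugeField P 0 U1) (θ : ℝ), 0 ≤ θ → (∀ (y : Balaban1983to89.Site P 0) (μ ν : Fin P.d), ‖plaqC U y μ ν - 1‖ ≤ θ) →
        (((P.L : ℝ) ^ k) ^ 2 * θ) ^ 2 ≤ 1 / 500 →
      ∀ (c M : Fin (d + 1) → ℕ), (∀ i, 1 ≤ M i) → (∀ i, c i * P.L ^ k + P.L ^ k * M i ≤ P.sitesPerDir 0) →
        (∀ i, P.L ^ k * M i < P.sitesPerDir 0) →
      2 * (P.d : ℝ) ^ 3 * (((P.L : ℝ) ^ k) ^ 2 * θ) ^ 2 ≤ 1 ∧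
      (∀ x ∈ cubeT hPd (P.L ^ k) c (fun i => P.L ^ k * M i), ∀ (f : Balaban1983to89.Site P 0 → ℂ) (F D : ℝ),
          (∀ y, ‖f y‖ ≤ F) → 0 ≤ D → (∀ y, f y ≠ 0 → D ≤ B5Ineq137Torus.T P 0 x y) →
          ‖(gBox (B1RG242Torus.α P a k * (P.L : ℝ) ^ (k * P.d)) P.eps⁻¹ U k (cubeT hPd (P.L ^ k) c fun i => P.L ^ k * M i) *ᵥ f) x‖ ≤
            P.spacing k ^ 2 * (c₀ * Real.exp (-(δ₀ * (((P.L : ℝ) ^ k)⁻¹ * D))) * F)) ∧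
      (∀ x ∈ cubeT hPd (P.L ^ k) c (fun i => P.L ^ k * M i), ∀ (f : Balaban1983to89.Site P 0 → ℂ) (F D : ℝ),
          (∀ y, ‖f y‖ ≤ F) → 0 ≤ D → (∀ y, f y ≠ 0 → D ≤ B5Ineq137Torus.T P 0 x y) →
          ‖(gBox (B1RG242Torus.α P a k * (P.L : ℝ) ^ (k * P.d)) P.eps⁻¹ U k univ *ᵥ f) x‖ ≤
            P.spacing k ^ 2 * (c₀ * Real.exp (-(δ₀ * (((P.L : ℝ) ^ k)⁻¹ * D))) * F)) ∧
      (∀ x, (∀ y, B5Ineq137Torus.T P 0 x y < (P.L : ℝ) ^ k → y ∈ cubeT hPd (P.L ^ k) c (fun i => P.L ^ k * M i)) →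
          ∀ (f : Balaban1983to89.Site P 0 → ℂ) (F D : ℝ), (∀ y, ‖f y‖ ≤ F) → 0 ≤ D →
          (∀ y, f y ≠ 0 → D ≤ B5Ineq137Torus.T P 0 x y) → ∀ (μ : Fin P.d),
          ‖covD P.eps⁻¹ (cfg U) (gBox (B1RG242Torus.α P a k * (P.L : ℝ) ^ (k * P.d)) P.eps⁻¹ U k
              (cubeT hPd (P.L ^ k) c fun i => P.L ^ k * M i) *ᵥ f) ⟨x, μ⟩‖ ≤
            P.spacing k * (c₀ * Real.exp (-(δ₀ * (((P.L : ℝ) ^ k)⁻¹ * D))) * F)) ∧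
      (∀ x, (∀ y, B5Ineq137Torus.T P 0 x y < (P.L : ℝ) ^ k → y ∈ cubeT hPd (P.L ^ k) c (fun i => P.L ^ k * M i)) →
          ∀ (f : Balaban1983to89.Site P 0 → ℂ) (F D : ℝ), (∀ y, ‖f y‖ ≤ F) → 0 ≤ D →
          (∀ y, f y ≠ 0 → D ≤ B5Ineq137Torus.T P 0 x y) → ∀ (μ : Fin P.d),
          ‖covD P.eps⁻¹ (cfg U) (gBox (B1RG242Torus.α P a k * (P.L : ℝ) ^ (k * P.d)) P.eps⁻¹ U k univ *ᵥ f) ⟨x, μ⟩‖ ≤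
            P.spacing k * (c₀ * Real.exp (-(δ₀ * (((P.L : ℝ) ^ k)⁻¹ * D))) * F)) := by
  obtain ⟨δa, ca, hδa, hca, HA⟩ := decay110_smallField_input (d + 1) (ℓ + 1) (Nat.succ_pos d) hd3 ⟨hodd, by omega⟩ ha
  obtain ⟨δb, cb, hδb, hcb, HB⟩ := decay110_smallPlaquette_cube_uniform d ℓ hd3 hℓ ha
  obtain ⟨tc, cc, htc, hcc, HCd⟩ := decay110_smallField_deriv (d + 1) (ℓ + 1) (by omega) hd3 ⟨hodd, by omega⟩ ha
  obtain ⟨td, cd, htd, hcd, HDd⟩ := decay110_smallPlaquette_cube_deriv_uniform_input d (ℓ + 1) hd1 hd3 ⟨hodd, by omega⟩ ha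
  set c₀ : ℝ := max (max ca cb) (max cc cd) with hc₀def
  set δ₀ : ℝ := min (min δa δb) (min tc td) with hδ₀def
  have hc₀ : 0 ≤ c₀ := hca.le.trans ((le_max_left _ _).trans (le_max_left _ _))
  have hδ₀ : 0 < δ₀ := lt_min (lt_min hδa hδb) (lt_min htc htd)
  have hca' : ca ≤ c₀ := (le_max_left _ _).trans (le_max_left _ _)
  have hcb' : cb ≤ c₀ := (le_max_right _ _).trans (le_max_left _ _)
  have hcc' : cc ≤ c₀ := (le_max_left _ _).trans (le_max_right _ _)
  have hcd' : cd ≤ c₀ := (le_max_right _ _).trans (le_max_right _ _)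
  have hδa' : δ₀ ≤ δa := (min_le_left _ _).trans (min_le_left _ _)
  have hδb' : δ₀ ≤ δb := (min_le_left _ _).trans (min_le_right _ _)
  have htc' : δ₀ ≤ tc := (min_le_right _ _).trans (min_le_left _ _)
  have htd' : δ₀ ≤ td := (min_le_right _ _).trans (min_le_right _ _)
  refine ⟨c₀, δ₀, hc₀, hδ₀, ?_⟩
  intro P hPd hPL k hk1 hkK hbig U θ hθ0 hθ hτ c M hM hfit hN
  have hkm : k ≤ P.m + P.K := hkK.trans (Nat.le_add_left _ _)
  have hLr : (1 : ℝ) ≤ (P.L : ℝ) ^ k := one_le_pow₀ (B1RG242Torus.one_lt_cast_L P).le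
  have hPk : (0 : ℝ) < (P.L : ℝ) ^ k := pow_pos P.cast_L_pos k
  have hdr : (P.d : ℝ) = (d : ℝ) + 1 := by rw [hPd]; push_cast; ring
  have hd1r : (1 : ℝ) ≤ P.d := by rw [hdr]; linarith [(Nat.cast_nonneg d : (0 : ℝ) ≤ d)]
  have hd3r : (P.d : ℝ) ≤ 3 := by rw [hPd]; exact_mod_cast hd3
  obtain ⟨hsm1, hsm2⟩ := threshold_smallness hd1r hd3r hLr hθ0 hτ
  have hsk2 : 0 ≤ P.spacing k ^ 2 := sq_nonneg _
  have hsk : 0 ≤ P.spacing k := (P.spacing_pos k).le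
  have hplaq : ∀ p : Balaban1983to89.Plaq P 0, ‖toC (GaugeField.plaqHol U p) - 1‖ ≤ θ := by
    rintro ⟨y, μ, ν, hμν⟩
    rw [← plaqC_eq_toC_plaqHol U y hμν]; exact hθ y μ ν
  have hT : ((P.d - 1 : ℕ) : ℝ) * ((P.L : ℝ) ^ k - 1) * θ ≤ ((P.d : ℝ) - 1) * ((P.L : ℝ) ^ k - 1) * θ := by
    rw [Nat.cast_sub P.hd, Nat.cast_one]
  refine ⟨hsm1, ?_, ?_, ?_, ?_⟩
  · -- the cube value member at `(c₀, δ₀)`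
    intro x _ f F D hF hD hsupp
    have hF0 : 0 ≤ F := (norm_nonneg _).trans (hF x)
    refine (HB P hPd hPL k hk1 hkm hbig U θ hθ0 hplaq _ hT hsm2 c M hM hfit hN x f F D hF hsupp).trans ?_
    exact mul_le_mul_of_nonneg_left (mono_bound hcb.le hcb' hδb' (mul_nonneg (inv_pos.2 hPk).le hD) hF0) hsk2
  · -- the torus value member at `(c₀, δ₀)`
    intro x _ f F D hF hD hsupp
    have hF0 : 0 ≤ F := (norm_nonneg _).trans (hF x)
    refine (HA P hPd hPL k hk1 hkK U θ hθ hsm1 x f F D hF hsupp).trans ?_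
    exact mul_le_mul_of_nonneg_left (mono_bound hca.le hca' hδa' (mul_nonneg (inv_pos.2 hPk).le hD) hF0) hsk2
  · -- the cube covariant-derivative member at `(c₀, δ₀)`
    intro x hball f F D hF hD hsupp μ
    have hF0 : 0 ≤ F := (norm_nonneg _).trans (hF x)
    refine (HDd P hPd hPL k hk1 hkK hbig U θ hθ0 hplaq hsm1 _ hT hsm2 c M hM hfit hN x hball f F D hF hsupp μ).trans ?_
    exact mul_le_mul_of_nonneg_left (mono_bound hcd.le hcd' htd' (mul_nonneg (inv_pos.2 hPk).le hD) hF0) hsk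
  · -- the torus covariant-derivative member at `(c₀, δ₀)`
    intro x _ f F D hF hD hsupp μ
    have hF0 : 0 ≤ F := (norm_nonneg _).trans (hF x)
    have h := HCd P hPd hPL k hk1 hkK U θ hθ hsm1 x μ f F D hF
      (fun z hz => by rw [← B3Bound323ZeroTorus.T_eq_supDist]; exact hsupp z hz)
    have e : cc * P.spacing k * Real.exp (-(tc * D / (P.L : ℝ) ^ k)) * F =
        P.spacing k * (cc * Real.exp (-(tc * (((P.L : ℝ) ^ k)⁻¹ * D))) * F) := by
      rw [show tc * D / (P.L : ℝ) ^ k = tc * (((P.L : ℝ) ^ k)⁻¹ * D) by rw [div_eq_mul_inv]; ring]; ring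
    rw [e] at h
    refine h.trans ?_
    exact mul_le_mul_of_nonneg_left (mono_bound hcc.le hcc' htc' (mul_nonneg (inv_pos.2 hPk).le hD) hF0) hsk

/-! ## §3 The Hölder member for (torus cube, whole torus), hypothesis-free -/

/-- **[Balaban1983RegularityDecay] (1.9), (1.11)–(1.12), HÖLDER MEMBER (ORDER `1+α`), FOR A TORUS CUBE AGAINST THE WHOLE TORUS AT A
SMALL-PLAQUETTE `U(1)` FIELD, HYPOTHESIS-FREE** (this seat's `closeHolder112_smallField_of_inputs110` with its four (H1.10″) inputs
discharged by §2): for `1 ≤ d`, `d + 1 ≤ 3`, `ℓ ≥ 1` with `ℓ + 1` odd, `a > 0`, `0 ≤ α < 1` there are `c₃, δ₃ > 0` such that for every volume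
(`P.d = d + 1`, `P.L = ℓ + 1`), every `1 ≤ k ≤ K` with `2(L^k − 1) + 4 < |T|`, every `u` with `‖u(∂p) − 1‖ ≤ θ`, `0 ≤ θ`, `(L^{2k}θ)² ≤ 1/500`,
every cube `□ = cubeT (L^k) c (L^kM)` (`M_i ≥ 1`, fitting, `L^kM_i < |T|`), every pair of distinct rows `x₀ ≠ x₁` of `□` with
`dist_∞(x_i, T ∖ □) ≥ 17L^k`, every `μ` and every `f` supported in `□`:
`(L^k/T(x₀,x₁))^α·‖U(Γ_{x₀,x₁})(D_uv)(⟨x₁,μ⟩) − (D_uv)(⟨x₀,μ⟩)‖ ≤ (L^kε)·c₃e^{−δ₃D/L^k}e^{−δ₃(D_b+D_f)/L^k}·F`, `v = G_k(□,u)f − G_k(T,u)f`,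
`Γ = stairHol u x₀ x₁`.
[cite: Balaban1983RegularityDecay, Theorem p.573 (1.9), (1.11)–(1.12)] [cite: BalabanImbrieJaffe1985, (7.3.1) p.326] -/
theorem closeHolder112_smallPlaquette_cube_torus (d ℓ : ℕ) (hd1 : 1 ≤ d) (hd3 : d + 1 ≤ 3) (hℓ : 1 ≤ ℓ) (hodd : Odd (ℓ + 1)) {a : ℝ}
    (ha : 0 < a) {α : ℝ} (hα0 : 0 ≤ α) (hα1 : α < 1) :
    ∃ c₃ δ₃ : ℝ, 0 < c₃ ∧ 0 < δ₃ ∧ ∀ (P : Params) (hPd : P.d = d + 1), P.L = ℓ + 1 →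
      ∀ k : ℕ, 1 ≤ k → k ≤ P.K → 2 * (P.L ^ k - 1) + 4 < P.sitesPerDir 0 →
      ∀ (U : GaugeField P 0 U1) (θ : ℝ), 0 ≤ θ → (∀ (y : Balaban1983to89.Site P 0) (μ ν : Fin P.d), ‖plaqC U y μ ν - 1‖ ≤ θ) →
        (((P.L : ℝ) ^ k) ^ 2 * θ) ^ 2 ≤ 1 / 500 →
      ∀ (c M : Fin (d + 1) → ℕ), (∀ i, 1 ≤ M i) → (∀ i, c i * P.L ^ k + P.L ^ k * M i ≤ P.sitesPerDir 0) →
        (∀ i, P.L ^ k * M i < P.sitesPerDir 0) →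
      ∀ (x₀ x₁ : Balaban1983to89.Site P 0) (μ : Fin P.d), x₀ ≠ x₁ →
        x₀ ∈ cubeT hPd (P.L ^ k) c (fun i => P.L ^ k * M i) → x₁ ∈ cubeT hPd (P.L ^ k) c (fun i => P.L ^ k * M i) →
        (∀ w, w ∉ cubeT hPd (P.L ^ k) c (fun i => P.L ^ k * M i) → 17 * (P.L : ℝ) ^ k ≤ B5Ineq137Torus.T P 0 x₀ w) →
        (∀ w, w ∉ cubeT hPd (P.L ^ k) c (fun i => P.L ^ k * M i) → 17 * (P.L : ℝ) ^ k ≤ B5Ineq137Torus.T P 0 x₁ w) →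
      ∀ (f : Balaban1983to89.Site P 0 → ℂ) (F D Db Df : ℝ), (∀ y, ‖f y‖ ≤ F) →
        (∀ y, y ∉ cubeT hPd (P.L ^ k) c (fun i => P.L ^ k * M i) → f y = 0) →
        0 ≤ D → (∀ y, f y ≠ 0 → D ≤ B5Ineq137Torus.T P 0 x₀ y) → (∀ y, f y ≠ 0 → D ≤ B5Ineq137Torus.T P 0 x₁ y) →
        0 ≤ Db → (∀ w, w ∉ cubeT hPd (P.L ^ k) c (fun i => P.L ^ k * M i) → Db ≤ B5Ineq137Torus.T P 0 x₀ w) →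
        (∀ w, w ∉ cubeT hPd (P.L ^ k) c (fun i => P.L ^ k * M i) → Db ≤ B5Ineq137Torus.T P 0 x₁ w) →
        0 ≤ Df → (∀ y, f y ≠ 0 → ∀ w, w ∉ cubeT hPd (P.L ^ k) c (fun i => P.L ^ k * M i) → Df ≤ B5Ineq137Torus.T P 0 y w) →
        ((P.L : ℝ) ^ k / B5Ineq137Torus.T P 0 x₀ x₁) ^ α *
            ‖stairHol U x₀ x₁ *
                covD P.eps⁻¹ (cfg U)
                  (gBox (B1RG242Torus.α P a k * (P.L : ℝ) ^ (k * P.d)) P.eps⁻¹ U k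
                      (cubeT hPd (P.L ^ k) c fun i => P.L ^ k * M i) *ᵥ f -
                    gBox (B1RG242Torus.α P a k * (P.L : ℝ) ^ (k * P.d)) P.eps⁻¹ U k univ *ᵥ f) ⟨x₁, μ⟩ -
              covD P.eps⁻¹ (cfg U)
                  (gBox (B1RG242Torus.α P a k * (P.L : ℝ) ^ (k * P.d)) P.eps⁻¹ U k
                      (cubeT hPd (P.L ^ k) c fun i => P.L ^ k * M i) *ᵥ f -
                    gBox (B1RG242Torus.α P a k * (P.L : ℝ) ^ (k * P.d)) P.eps⁻¹ U k univ *ᵥ f) ⟨x₀, μ⟩‖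
          ≤ P.spacing k * (c₃ * Real.exp (-(δ₃ * (((P.L : ℝ) ^ k)⁻¹ * D))) *
              Real.exp (-(δ₃ * (((P.L : ℝ) ^ k)⁻¹ * (Db + Df)))) * F) := by
  obtain ⟨c₀, δ₀, hc₀, hδ₀, HI⟩ := inputs110_smallPlaquette_cube_torus d ℓ hd1 hd3 hℓ hodd ha
  obtain ⟨c₃, δ₃, hc₃, hδ₃, H⟩ :=
    closeHolder112_smallField_of_inputs110 (d + 1) (ℓ + 1) (by omega) hd3 ⟨hodd, by omega⟩ ha hc₀ hδ₀ hα0 hα1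
  refine ⟨c₃, δ₃, hc₃, hδ₃, ?_⟩
  intro P hPd hPL k hk1 hkK hbig U θ hθ0 hθ hτ c M hM hfit hN x₀ x₁ μ hne hx₀ hx₁ hdeep₀ hdeep₁ f F D Db Df hF hfB hD hsD₀ hsD₁ hDb
    hsDb₀ hsDb₁ hDf hsDf
  have hkm : k ≤ P.m + P.K := hkK.trans (Nat.le_add_left _ _)
  obtain ⟨hsm1, hGB, hGΩ, hDB, hDΩ⟩ := HI P hPd hPL k hk1 hkK hbig U θ hθ0 hθ hτ c M hM hfit hN
  exact H P hPd hPL k hk1 hkK U θ hθ hsm1 _ univ (isBlockUnion_cubeT hPd hkm rfl hfit) (isBlockUnion_univ k) (subset_univ _) hGB hGΩ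
    hDB hDΩ x₀ x₁ μ hne hx₀ hx₁ hdeep₀ hdeep₁ f F D Db Df hF hfB hD hsD₀ hsD₁ hDb hsDb₀ hsDb₁ hDf hsDf

/-! ## §4 The same in the (H1.12)-Hölder input binder shape -/

/-- **§3 IN THE (H1.12)-HÖLDER INPUT BINDER SHAPE** (this seat's `closeHolder112_smallField_input110` with its four (H1.10″) inputs discharged
by §2): direction first, `x₁ ≠ x₀`, the deep rows as the ball conditions `T(x_i,y) ≤ 17L^k → y ∈ □`, no sign conditions on `D, D_b, D_f`,
transport `stairHol` — the hypothesis-free small-plaquette provider, for the pair (torus cube, whole torus), of a generic order-`(1+θ)` member of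
[BalabanImbrieJaffe1988] (2.31) read through the binder of r18's `BIJ88LocDerivHolder231RegularTorus.input112_holder_regular_univ`.
[cite: Balaban1983RegularityDecay, Theorem p.573 (1.9), (1.11)–(1.12)] [cite: BalabanImbrieJaffe1985, (7.3.1) p.326] [cite: BalabanImbrieJaffe1988, p.263, (2.31)] -/
theorem closeHolder112_smallPlaquette_cube_torus_input (d ℓ : ℕ) (hd1 : 1 ≤ d) (hd3 : d + 1 ≤ 3) (hℓ : 1 ≤ ℓ) (hodd : Odd (ℓ + 1))
    {a : ℝ} (ha : 0 < a) {α : ℝ} (hα0 : 0 ≤ α) (hα1 : α < 1) :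
    ∃ c₃ δ₃ : ℝ, 0 < c₃ ∧ 0 < δ₃ ∧ ∀ (P : Params) (hPd : P.d = d + 1), P.L = ℓ + 1 →
      ∀ k : ℕ, 1 ≤ k → k ≤ P.K → 2 * (P.L ^ k - 1) + 4 < P.sitesPerDir 0 →
      ∀ (U : GaugeField P 0 U1) (θ : ℝ), 0 ≤ θ → (∀ (y : Balaban1983to89.Site P 0) (μ ν : Fin P.d), ‖plaqC U y μ ν - 1‖ ≤ θ) →
        (((P.L : ℝ) ^ k) ^ 2 * θ) ^ 2 ≤ 1 / 500 →
      ∀ (c M : Fin (d + 1) → ℕ), (∀ i, 1 ≤ M i) → (∀ i, c i * P.L ^ k + P.L ^ k * M i ≤ P.sitesPerDir 0) →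
        (∀ i, P.L ^ k * M i < P.sitesPerDir 0) →
      ∀ (μ : Fin P.d) (x₀ x₁ : Balaban1983to89.Site P 0), x₁ ≠ x₀ →
        (∀ y, B5Ineq137Torus.T P 0 x₀ y ≤ 17 * (P.L : ℝ) ^ k → y ∈ cubeT hPd (P.L ^ k) c (fun i => P.L ^ k * M i)) →
        (∀ y, B5Ineq137Torus.T P 0 x₁ y ≤ 17 * (P.L : ℝ) ^ k → y ∈ cubeT hPd (P.L ^ k) c (fun i => P.L ^ k * M i)) →
      ∀ (f : Balaban1983to89.Site P 0 → ℂ) (F D Db Df : ℝ), (∀ y, ‖f y‖ ≤ F) →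
        (∀ y, y ∉ cubeT hPd (P.L ^ k) c (fun i => P.L ^ k * M i) → f y = 0) →
        (∀ y, f y ≠ 0 → D ≤ B5Ineq137Torus.T P 0 x₀ y) → (∀ y, f y ≠ 0 → D ≤ B5Ineq137Torus.T P 0 x₁ y) →
        (∀ w, w ∉ cubeT hPd (P.L ^ k) c (fun i => P.L ^ k * M i) → Db ≤ B5Ineq137Torus.T P 0 x₀ w) →
        (∀ w, w ∉ cubeT hPd (P.L ^ k) c (fun i => P.L ^ k * M i) → Db ≤ B5Ineq137Torus.T P 0 x₁ w) →
        (∀ y, f y ≠ 0 → ∀ w, w ∉ cubeT hPd (P.L ^ k) c (fun i => P.L ^ k * M i) → Df ≤ B5Ineq137Torus.T P 0 y w) →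
        ((P.L : ℝ) ^ k / B5Ineq137Torus.T P 0 x₀ x₁) ^ α *
            ‖stairHol U x₀ x₁ *
                covD P.eps⁻¹ (cfg U)
                  (gBox (B1RG242Torus.α P a k * (P.L : ℝ) ^ (k * P.d)) P.eps⁻¹ U k
                      (cubeT hPd (P.L ^ k) c fun i => P.L ^ k * M i) *ᵥ f -
                    gBox (B1RG242Torus.α P a k * (P.L : ℝ) ^ (k * P.d)) P.eps⁻¹ U k univ *ᵥ f) ⟨x₁, μ⟩ -
              covD P.eps⁻¹ (cfg U)
                  (gBox (B1RG242Torus.α P a k * (P.L : ℝ) ^ (k * P.d)) P.eps⁻¹ U k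
                      (cubeT hPd (P.L ^ k) c fun i => P.L ^ k * M i) *ᵥ f -
                    gBox (B1RG242Torus.α P a k * (P.L : ℝ) ^ (k * P.d)) P.eps⁻¹ U k univ *ᵥ f) ⟨x₀, μ⟩‖
          ≤ P.spacing k * (c₃ * Real.exp (-(δ₃ * (((P.L : ℝ) ^ k)⁻¹ * D))) *
              Real.exp (-(δ₃ * (((P.L : ℝ) ^ k)⁻¹ * (Db + Df)))) * F) := by
  obtain ⟨c₀, δ₀, hc₀, hδ₀, HI⟩ := inputs110_smallPlaquette_cube_torus d ℓ hd1 hd3 hℓ hodd ha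
  obtain ⟨c₃, δ₃, hc₃, hδ₃, H⟩ :=
    closeHolder112_smallField_input110 (d + 1) (ℓ + 1) (by omega) hd3 ⟨hodd, by omega⟩ ha hc₀ hδ₀ hα0 hα1
  refine ⟨c₃, δ₃, hc₃, hδ₃, ?_⟩
  intro P hPd hPL k hk1 hkK hbig U θ hθ0 hθ hτ c M hM hfit hN μ x₀ x₁ hne hball₀ hball₁ f F D Db Df hF hfB hsD₀ hsD₁ hsDb₀ hsDb₁ hsDf
  have hkm : k ≤ P.m + P.K := hkK.trans (Nat.le_add_left _ _)
  obtain ⟨hsm1, hGB, hGΩ, hDB, hDΩ⟩ := HI P hPd hPL k hk1 hkK hbig U θ hθ0 hθ hτ c M hM hfit hN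
  exact H P hPd hPL k hk1 hkK U θ hθ hsm1 _ univ (isBlockUnion_cubeT hPd hkm rfl hfit) (isBlockUnion_univ k) (subset_univ _) hGB hGΩ
    hDB hDΩ μ x₀ x₁ hne hball₀ hball₁ f F D Db Df hF hfB hsD₀ hsD₁ hsDb₀ hsDb₁ hsDf

end

end Literature.MathematicalPhysics.QuantumFieldTheory.BalabanImbrieJaffe1984to88.BIJ88NeumannPropagatorSmallFieldCloseHolderCubeTorus
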